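import Mathlib
import Summits.ValiantsHypothesis.ValiantsHypothesis.Theses.FifoMatching
import Summits.ValiantsHypothesis.ValiantsHypothesis.Theorems.FifoMatchingNNLinearDegreeCofactorHardAvoidingCounts
import Summits.ValiantsHypothesis.ValiantsHypothesis.Theorems.FifoMatchingNNLinearDegreeCofactorHardStubTopInternalComponent
import Summits.ValiantsHypothesis.ValiantsHypothesis.Theorems.FifoMatchingNNLinearDegreeCofactorHardStubLongRunInternalHard
import HarnessLib

/-!
# Route `FifoMatching`, crux `NNLinearDegreeCofactorHard` (stmt-ValiantsHypothesis-23918), line `internal_cofactor`: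
# the crux FROM THE COUNTS — sorry-free hypothesis-form assembly (director-valiant g11 R2/P2)

`nnLinearDegreeCofactorHard_of_avoidingCounts28 : AvoidingCounts 28 → …Theses.FifoMatching.NNLinearDegreeCofactorHard`, where
`AvoidingCounts 28` is — VERBATIM — the hypothesis of p3's landed `InternalCofactor.denseInternalHard_of_counts` at `a = 28`: for
every `c` and all large `n`, every admissible defect set `R` (`28·|R| ≤ 2n`, no defect-free run of the stub's length) and every good
carving carry a nonempty seed set `BB`, a map `f` into the R-avoiding nest-free perfect matchings, and, for every balanced split `S`,
the count `4·(2^((log₂ n + c)^c) + 1)·(m+1)² · #{y ∈ BB : f y respects S} < #BB`.  Composition (the registered skeleton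
`Cruxes/NNLinearDegreeCofactorHard/Lines/internal_cofactor.lean`, kernel-checked; val-idea-7's `state_keyed_counts.lean` /
val-idea-crit-3's `crit_glue`): S1 `InternalCofactor.stub_topInternalComponent` (p590074) + S2a `stub_longRunInternalHard` (p590091) +
S2b := `denseInternalHard_of_counts 28 le_rfl h`.

So the crux closes the moment a measure delivers the counts for EVERY `c` — the target of the ∀c re-method (μ* = `shedWord`, p1 g2;
deterministic heart (D*), LEAD-HANDOFF §p2); the exponent-2 rung stmt-24468 needs them for one `K = 2^((log₂ n)²/b)` only
(`InternalCofactor.quasiPolyHard_of_counts`).  Honest framing: a CONDITIONAL assembly (hypothesis = the open counts); nothing here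
proves the counts, S2b, the crux, `NNDivisionHard`, `NNNotVP` or VP ≠ VNP (NOT proved); monotone world only
(`Literature.Barriers.ValiantsHypothesis.MonotoneGap`).  No definitions, no named facts.
-/

noncomputable section

-- Sub = Summit single-conjunct layout: the duplicated namespace component is mandated by the tree.
set_option linter.dupNamespace false

namespace Summit.ValiantsHypothesis.ValiantsHypothesis.Theorems.FifoMatching.NNLinearDegreeCofactorHard.InternalCofactor

open MvPolynomial Finset Literature.Computability.AlgebraicComplexity
open Summit.ValiantsHypothesis.ValiantsHypothesis.Theorems.FifoMatching.NNLowDegreeCofactorHard.FreedVertices.Carve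
open Summit.ValiantsHypothesis.ValiantsHypothesis.Theorems.FifoMatching.NNLinearDegreeCofactorHard
open scoped NNReal

/-- **`NNLinearDegreeCofactorHard` from the avoiding counts at `a = 28`** (hypothesis = verbatim the hypothesis of
`denseInternalHard_of_counts 28`): S1 + S2a (landed) + S2b from the counts, composed exactly as the registered skeleton of line
`internal_cofactor`. [folklore] -/
theorem nnLinearDegreeCofactorHard_of_avoidingCounts28
    (h : ∀ c : ℕ, ∃ n₀ : ℕ, ∀ n ≥ n₀, ∀ R : Finset (Fin (2 * n)), 28 * R.card ≤ 2 * n →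
      (¬ ∃ s : ℕ, s + (2 * ((Nat.log 2 n + c) ^ c + Nat.log 2 n + 1) ^ 6 + 12) ≤ 2 * n ∧
        ∀ j : Fin (2 * n), s ≤ j.val →
          j.val < s + (2 * ((Nat.log 2 n + c) ^ c + Nat.log 2 n + 1) ^ 6 + 12) → j ∉ R) →
      ∀ C : Carving n, 3 ≤ C.m → 2 * n ≤ 2 * C.m + 12 * R.card + 4 →
        (∀ t ≤ 2 * C.m,
          4 * ((univ.filter fun j : Fin (2 * C.m) => C.up j ∈ R).filter fun j => j.val < t).card ≤ t ∧
          4 * ((univ.filter fun j : Fin (2 * C.m) => C.up j ∈ R).filter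
            fun j => 2 * C.m ≤ j.val + t).card ≤ t) →
        ∃ B : ℕ, ∃ BB : Finset (Fin B → Bool), ∃ f : (Fin B → Bool) → (Fin (2 * C.m) → Fin (2 * C.m)),
          BB.Nonempty ∧
          (∀ y ∈ BB, f y ∈ (nestFreeMatchings (2 * C.m)).filter
            (fun N => ∀ j ∈ (univ.filter fun j : Fin (2 * C.m) => C.up j ∈ R),
              N j ∉ (univ.filter fun j : Fin (2 * C.m) => C.up j ∈ R))) ∧
          ∀ S : Finset (Fin (2 * C.m)), 2 * C.m < 3 * S.card → 3 * S.card ≤ 4 * C.m →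
            (4 * (2 ^ ((Nat.log 2 n + c) ^ c) + 1) * (C.m + 1) ^ 2) *
              (BB.filter fun y => ∀ i, i ∈ S ↔ f y i ∈ S).card < BB.card) :
    Summit.ValiantsHypothesis.ValiantsHypothesis.Theses.FifoMatching.NNLinearDegreeCofactorHard := by
  have hS2b := denseInternalHard_of_counts 28 le_rfl h
  refine ⟨28, fun c => ?_⟩
  obtain ⟨n₁, hn₁⟩ := stub_longRunInternalHard c
  obtain ⟨n₂, hn₂⟩ := hS2b c
  refine ⟨max n₁ n₂, fun n hn g hg hdeg => ?_⟩
  obtain ⟨R, hR, p, hp, hpdeg, hint, hpc⟩ := stub_topInternalComponent n g hg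
  have hRa : 28 * R.card ≤ 2 * n :=
    calc 28 * R.card ≤ 28 * (2 * g.totalDegree) := Nat.mul_le_mul_left 28 hR
      _ = 2 * (28 * g.totalDegree) := by ring
      _ ≤ 2 * n := Nat.mul_le_mul_left 2 hdeg
  have hpa : 28 * p.totalDegree ≤ n := (Nat.mul_le_mul_left 28 hpdeg).trans hdeg
  have key : 2 ^ ((Nat.log 2 n + c) ^ c) < complexity (nestFreeMatchingPoly n ℝ≥0 * p) := by
    by_cases hrun : ∃ s : ℕ, s + (2 * ((Nat.log 2 n + c) ^ c + Nat.log 2 n + 1) ^ 6 + 12) ≤ 2 * n ∧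
        ∀ j : Fin (2 * n), s ≤ j.val →
          j.val < s + (2 * ((Nat.log 2 n + c) ^ c + Nat.log 2 n + 1) ^ 6 + 12) → j ∉ R
    · exact hn₁ n (le_of_max_le_left hn) R hrun p hp hint
    · exact hn₂ n (le_of_max_le_right hn) R hRa hrun p hp hpa hint
  show 2 ^ ((Nat.log 2 n + c) ^ c) <
    complexity (nestFreeMatchingPoly n ℝ≥0 * g) + complexity g
  calc 2 ^ ((Nat.log 2 n + c) ^ c) < complexity (nestFreeMatchingPoly n ℝ≥0 * p) := key
    _ ≤ complexity (nestFreeMatchingPoly n ℝ≥0 * g) := hpc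
    _ ≤ complexity (nestFreeMatchingPoly n ℝ≥0 * g) + complexity g := Nat.le_add_right _ _

end Summit.ValiantsHypothesis.ValiantsHypothesis.Theorems.FifoMatching.NNLinearDegreeCofactorHard.InternalCofactor

end
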